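import Summits.BirchSwinnertonDyer.BirchSwinnertonDyer.Theorems.GoldfeldAllTwistsTwoConverseTwinBirchLemma
import Summits.BirchSwinnertonDyer.BirchSwinnertonDyer.Theorems.GoldfeldAllTwistsTwoConverseTwinHeegnerIndexX049
import Summits.BirchSwinnertonDyer.BirchSwinnertonDyer.Theorems.GoldfeldAllTwistsTwoConverseTwinAdditiveSign
import HarnessLib

set_option linter.dupNamespace false -- namespace `…BirchSwinnertonDyer.BirchSwinnertonDyer…` is the cell's (D-0017 nested layout)
set_option autoImplicit false

/-!
# LINE B49, file 3 — the FORMULA-axis consumer of `X049BirchLemmaEvenDiscr` and the honesty clause: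
# B49 ⟹ twin″ ∧ K12₂″ on the inert prime-twist family `49a1^{(−q)}`; twin″ ∧ K12₂″ ⟹ B49

Cell `bsd-goldfeld`, seat `bsd-goldfeld-s1p-c301` (prover, gen 4), `--supports stmt-BirchSwinnertonDyer-19140`
(route decl `Summit.BirchSwinnertonDyer.BirchSwinnertonDyer.Theses.GoldfeldAllTwistsTwoConverse.BSDTwoCMSevenAdditiveRankOne`,
twin″; joint with item 20044 K12₂″ `…RankOneTwoConverseCMSevenAdditiveTwo`). Both items are OPEN mathematics; NOTHING
HERE PROVES EITHER. THEOREMS ONLY. HONEST FRAMING: BSD is not proved by any of this; LINE B49 is a rung on the prime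
sub-family (density zero among all twists), not a closure of S1⁺.

* §1 `shaAn_eq_x049HeegnerTwistQuotient`: file 2b's identity in file 1's words — `#Ш_an(W) = 𝔮₄₉ =
  x049HeegnerTwistQuotient K P Dt.c k W Cd.u` for every minimal model `W` of `49a1^{(−q)}` of analytic rank one.
* §2 **FORMULA AXIS** `bsdp_two_inertPrimeTwist_of_birch`: `X049BirchLemmaEvenDiscr` ⟹ `BSD(W, 2)` for EVERY globally
  minimal model `W` of `49a1^{(−q)}`, EVERY prime `q ≡ 1 (mod 4)` inert in `ℚ(√−7)` — clause (i) discharges the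
  analytic-rank hypothesis (file 1, Conjecture D(q)), clause (ii) is `ord₂ 𝔮₄₉ = 0`, and file 2b's
  `bsdp_two_iff_x049Quotient_unit_inertPrimeTwist` converts. With file 1's rank-axis consumer:
  `cruxes_inertPrimeTwist_of_birch` — on the family BOTH open cruxes of S1⁺ hold (`r_an = 1`, `BSD(W,2)`,
  `rank W(ℚ) = 1`, `Ш(W/ℚ)[2^∞] = 0`), granted the cell's standing published binders.
* §3 **HONESTY** `birch_of_cruxes`: conversely the two route decls (twin″ BY NAME and K12₂″ BY NAME) imply
  `X049BirchLemmaEvenDiscr`, granted the same binders plus `2`-parity — so LINE B49 is EXACTLY the joint content of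
  the two cruxes on the prime family `{49a1^{(−q)}}`, made `L`-free and explicit (a `2`-divisibility of one Heegner
  point), neither weaker nor stronger.

References: B. Gross, D. Zagier, Invent. Math. 84 (1986) Thm. I.(6.3), V.§2 [GrossZagier1986]; B. Gross (1991) (1.1),
Prop. 2.3 [Gross1991]; A. Burungale, M. Flach (2024) Thm. 1.1, Cor. 2 [BurungaleFlach2024]; J. Coates, Y. Li, Y. Tian,
S. Zhai, PLMS 110 (2015) Thm. 1.2, 1.4 [CoatesLiTianZhai2015]; R. L. Miller, LMS JCM 14 (2011) Def. 1.1 [Miller2011LMS];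
T. Dokchitser, V. Dokchitser, Ann. of Math. 172 (2010) Thm. 1.4 [DokchitserDokchitserAnnals2010].
-/

noncomputable section

open scoped Classical

open WeierstrassCurve NumberField Literature.NumberTheory Literature.NumberTheory.EllipticCurves
  Literature.NumberTheory.EllipticCurves.ModularForms
  Literature.NumberTheory.EllipticCurves.Rank1Residual
  Summit.BirchSwinnertonDyer.Rank1Residual.P2

namespace Summit.BirchSwinnertonDyer.BirchSwinnertonDyer.Theorems.GoldfeldGoodTwists

/-! ## §1 The identity in file 1's words -/

/-- **`#Ш_an(W) = 𝔮₄₉ = x049HeegnerTwistQuotient K P c k W u`** for every globally minimal model `W = Cd • X₀(49)^{(d_K)}`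
of `49a1^{(−q)}` of analytic rank one (`q` prime, `(q/7) = −1`, `K` imaginary quadratic with `d_K = −4q`, `P` the
Heegner point of a datum `(Dt, H, ι)` at level `49`, `k` THE halvability value) — file 2b's
`shaAn_eq_x049Quotient_inertPrimeTwist`, whose quotient is file 1's definition verbatim.
[cite: GrossZagier1986, Thm. I.(6.3) and V.§2] [cite: BurungaleFlach2024, Thm. 1.1 and Cor. 2 (p. 4)] -/
theorem shaAn_eq_x049HeegnerTwistQuotient (hnf : ModularForms.exists_isNewformOf)
    (h12 : CoatesLiTianZhai2015.thm12_fullBSD_twist) (hBF : bsdTriple_of_hasCM_of_L_one_ne_zero)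
    (hGZ : ∀ (N : ℕ) [NeZero N] (W : WeierstrassCurve ℚ) (K : Type) [Field K] [NumberField K],
      gross_zagier N W K)
    (hKo : ∀ (N : ℕ) [NeZero N] (W : WeierstrassCurve ℚ) (K : Type) [Field K] [NumberField K],
      kolyvagin N W K)
    (hGZK : rank_eq_analyticRank_of_analyticRank_le_one)
    {q : ℕ} (hq7 : jacobiSym q 7 = -1) (K : Type) [Field K] [NumberField K] (hK : IsImaginaryQuadratic K)
    (hdK : NumberField.discr K = -(4 * (q : ℤ)))
    (Dt : ModularParametrizationData cm7 49) (H : HeegnerDatum 49 (NumberField.discr K)) (ι : K →+* ℂ)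
    (P : (cm7.baseChange K).toAffine.Point)
    (hP : WeierstrassCurve.Affine.Point.map ι.toRatAlgHom P = heegnerPointComplex Dt H)
    (W : WeierstrassCurve ℚ) [W.IsElliptic] [W.IsGloballyMinimal] (Cd : VariableChange ℚ)
    (hW : Cd • cm7.quadraticTwist (NumberField.discr K : ℚ) = W) (hr : W.analyticRank = 1) :
    ∃ k : ℕ, (k = 1 ∨ k = 2) ∧
      (k = 2 ↔ ∀ y : W.toAffine.Point, ∃ Q : (W.baseChange K).toAffine.Point,
        QuadraticDescent.incl K W y - (2 : ℤ) • Q ∈ AddCommGroup.torsion (W.baseChange K).toAffine.Point) ∧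
      shaAn W = (x049HeegnerTwistQuotient K P Dt.c k W Cd.u : ℂ) := by
  obtain ⟨-, -, -, k, hk12, hkiff, hsha⟩ := shaAn_eq_x049Quotient_inertPrimeTwist hnf h12 hBF hGZ hKo hGZK hq7 K hK
    hdK Dt H ι P hP W Cd hW hr
  exact ⟨k, hk12, hkiff, hsha⟩

/-! ## §2 The formula axis: B49 ⟹ `BSD(W,2)` on the family; both cruxes on the family -/

/-- A model `W` with `C • W = X₀(49)^{(−q)}` is `Cd • X₀(49)^{(d_K)}` for `d_K = −4q` and an explicit `Cd`
(`X₀(49)^{(−4q)} = ⟨2⁻¹,0,0,0⟩ • X₀(49)^{(−q)}`). [cite: SilvermanAEC2009, X.5 Prop. 5.4] -/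
theorem exists_smul_twist_discr_eq_of_smul_eq_twist_neg {q : ℕ} (K : Type) [Field K] [NumberField K]
    (hdK : NumberField.discr K = -(4 * (q : ℤ))) (W : WeierstrassCurve ℚ) (C : VariableChange ℚ)
    (hC : C • W = cm7.quadraticTwist ((-q : ℤ) : ℚ)) :
    ∃ Cd : VariableChange ℚ, Cd • cm7.quadraticTwist (NumberField.discr K : ℚ) = W := by
  have htw : cm7.quadraticTwist (NumberField.discr K : ℚ) =
      (⟨(Units.mk0 (2 : ℚ) two_ne_zero)⁻¹, 0, 0, 0⟩ : VariableChange ℚ) • cm7.quadraticTwist ((-q : ℤ) : ℚ) := by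
    rw [hdK, show ((-q : ℤ) : ℚ) = ((-(q : ℤ) : ℤ) : ℚ) by push_cast; ring,
      show ((-(4 * (q : ℤ)) : ℤ) : ℚ) = ((4 * (-(q : ℤ)) : ℤ) : ℚ) by push_cast; ring]
    exact quadraticTwist_cm7_four_mul (-(q : ℤ))
  refine ⟨((⟨(Units.mk0 (2 : ℚ) two_ne_zero)⁻¹, 0, 0, 0⟩ : VariableChange ℚ) * C)⁻¹, ?_⟩
  rw [htw, ← hC, smul_smul, smul_smul, mul_assoc, inv_mul_cancel, one_smul]

/-- **THE FORMULA-AXIS CONSUMER: `X049BirchLemmaEvenDiscr` ⟹ twin″ ON THE INERT PRIME-TWIST FAMILY.** For every prime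
`q ≡ 1 (mod 4)` with `(−7/q) = −1` and EVERY globally minimal elliptic `W/ℚ` with `C • W = X₀(49)^{(−q)}` (the minimal
models of `49a1^{(−q)}`): `BSD(W, 2)`. Granted Modularity (`hnf`), Coates–Li–Tian–Zhai Thm. 1.2 at `R = 1` (`h12`),
Burungale–Flach 2024 (`hBF`), Gross–Zagier (`hGZ`), Kolyvagin (`hKo`), GZK (`hGZK`), Heegner rationality (`hHP`).
Proof: `K = ℚ(√−q)` (`d_K = −4q`), a Heegner point `P ∈ X₀(49)(K)` with its datum; clause (i) of B49 gives
`ord_{s=1} L(W,s) = 1` (file 1); file 2b gives THE `k` with `BSD(W,2) ⟺ ord₂ 𝔮₄₉(k) = 0`; clause (ii) of B49 at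
that `k` is `ord₂ 𝔮₄₉(k) = 0`. [cite: Miller2011LMS, Def. 1.1] [cite: GrossZagier1986, Thm. I.(6.3) and V.§2]
[cite: BurungaleFlach2024, Thm. 1.1 and Cor. 2 (p. 4)] -/
theorem bsdp_two_inertPrimeTwist_of_birch (hnf : ModularForms.exists_isNewformOf)
    (h12 : CoatesLiTianZhai2015.thm12_fullBSD_twist) (hBF : bsdTriple_of_hasCM_of_L_one_ne_zero)
    (hGZ : ∀ (N : ℕ) [NeZero N] (W : WeierstrassCurve ℚ) (K : Type) [Field K] [NumberField K],
      gross_zagier N W K)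
    (hKo : ∀ (N : ℕ) [NeZero N] (W : WeierstrassCurve ℚ) (K : Type) [Field K] [NumberField K],
      kolyvagin N W K)
    (hGZK : rank_eq_analyticRank_of_analyticRank_le_one)
    (hHP : ∀ (W : WeierstrassCurve ℚ) (K : Type) [Field K] [NumberField K], exists_isHeegnerPoint W K)
    (hB : X049BirchLemmaEvenDiscr) {q : ℕ} [Fact q.Prime] (hq4 : q % 4 = 1) (hq7 : legendreSym q (-7) = -1)
    (W : WeierstrassCurve ℚ) [W.IsElliptic] [W.IsGloballyMinimal] (C : VariableChange ℚ)
    (hC : C • W = cm7.quadraticTwist ((-q : ℤ) : ℚ)) : BSDp W 2 := by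
  have hq : q.Prime := Fact.out
  have hqj : jacobiSym q 7 = -1 := by rw [jacobiSym_seven_eq_legendreSym_neg_seven hq4, hq7]
  have har : W.analyticRank = 1 := analyticRank_eq_one_inertPrimeTwist_of_birch' hnf h12 hGZ hHP hB hq4 hq7 W C hC
  have hsq : Squarefree (-(q : ℤ)) := by
    rw [← Int.squarefree_natAbs, Int.natAbs_neg, Int.natAbs_natCast]
    exact hq.squarefree
  -- `K = ℚ(√−q)`, `d_K = −4q`, `7` split
  obtain ⟨K, _, _, h2, hdK⟩ := QuadraticFields.Quadratic.exists_numberField_discr_eq (D := 4 * (-(q : ℤ)))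
    (Or.inr ⟨dvd_mul_right 4 _, by rw [show 4 * (-(q : ℤ)) / 4 = -(q : ℤ) by omega]; omega,
      by rw [show 4 * (-(q : ℤ)) / 4 = -(q : ℤ) by omega]; exact hsq⟩)
  have hK : IsImaginaryQuadratic K :=
    isImaginaryQuadratic_iff_discr_neg.mpr ⟨h2, by rw [hdK]; have := hq.pos; omega⟩
  have hdK' : NumberField.discr K = -(4 * (q : ℤ)) := by rw [hdK]; ring
  haveI : NeZero (cm7.conductorNorm ℤ) := ⟨(cm7.conductorNorm_pos_holds).ne'⟩
  have hH : SatisfiesHeegnerHypothesis 49 K :=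
    satisfiesHeegnerHypothesis_fortyNine_of_discr_eq K h2 hdK (jacobiSym_neg_prime_seven hqj)
  have hH' : SatisfiesHeegnerHypothesis (cm7.conductorNorm ℤ) K := by rw [conductorNorm_cm7]; exact hH
  -- a Heegner point with its datum
  obtain ⟨P, hP0⟩ := hHP cm7 K hK hH'
  obtain ⟨Dt, H, ι, hP⟩ := isHeegnerPoint_of_level_eq conductorNorm_cm7 hP0
  -- `W = Cd • X₀(49)^{(d_K)}`
  obtain ⟨Cd, hCd⟩ := exists_smul_twist_discr_eq_of_smul_eq_twist_neg K hdK' W C hC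
  -- file 2b: THE `k` and `BSD(W,2) ⟺ ord₂ 𝔮₄₉(k) = 0`; clause (ii) of B49 at that `k`
  obtain ⟨k, hk12, hkiff, hiff⟩ := bsdp_two_iff_x049Quotient_unit_inertPrimeTwist hnf h12 hBF hGZ hKo hGZK hq4 hq7
    K hK hdK' Dt H ι P hP W Cd hCd har
  exact hiff.mpr (hB q K Dt H ι P W Cd k hq hqj hK hdK' hP hCd hk12 hkiff).2

/-- **B49 ⟹ BOTH OPEN CRUXES OF S1⁺ ON THE INERT PRIME-TWIST FAMILY.** For every prime `q ≡ 1 (mod 4)` inert in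
`ℚ(√−7)` and every globally minimal model `W` of `49a1^{(−q)}`: `ord_{s=1} L(W, s) = 1` (K12₂″'s conclusion;
Conjecture D(q)), `BSD(W, 2)` (twin″'s conclusion), `rank W(ℚ) = 1` and `Ш(W/ℚ)[2^∞] = 0`.
[cite: CoatesLiTianZhai2015, Thm. 1.4 (p. 360)] [cite: Miller2011LMS, Def. 1.1] [cite: GrossZagier1986, Thm. I.(6.3)] -/
theorem cruxes_inertPrimeTwist_of_birch (hnf : ModularForms.exists_isNewformOf)
    (h12 : CoatesLiTianZhai2015.thm12_fullBSD_twist) (hBF : bsdTriple_of_hasCM_of_L_one_ne_zero)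
    (hGZ : ∀ (N : ℕ) [NeZero N] (W : WeierstrassCurve ℚ) (K : Type) [Field K] [NumberField K],
      gross_zagier N W K)
    (hKo : ∀ (N : ℕ) [NeZero N] (W : WeierstrassCurve ℚ) (K : Type) [Field K] [NumberField K],
      kolyvagin N W K)
    (hGZK : rank_eq_analyticRank_of_analyticRank_le_one)
    (hHP : ∀ (W : WeierstrassCurve ℚ) (K : Type) [Field K] [NumberField K], exists_isHeegnerPoint W K)
    (hB : X049BirchLemmaEvenDiscr) {q : ℕ} [Fact q.Prime] (hq4 : q % 4 = 1) (hq7 : legendreSym q (-7) = -1)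
    (W : WeierstrassCurve ℚ) [W.IsElliptic] [W.IsGloballyMinimal] (C : VariableChange ℚ)
    (hC : C • W = cm7.quadraticTwist ((-q : ℤ) : ℚ)) :
    W.analyticRank = 1 ∧ BSDp W 2 ∧ W.mordellWeilRank = 1 ∧ AddCommGroup.primaryComponent W.sha 2 = ⊥ := by
  obtain ⟨har, hrk, hbot, -, -⟩ := structure_inertPrimeTwist_of_birch hnf h12 hGZ hHP hGZK hB hq4 hq7 W C hC
  exact ⟨har, bsdp_two_inertPrimeTwist_of_birch hnf h12 hBF hGZ hKo hGZK hHP hB hq4 hq7 W C hC, hrk, hbot⟩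

/-! ## §3 Honesty: the two cruxes imply B49 -/

/-- For a prime `q` with `(q/7) = −1` and a quadratic field of discriminant `−4q`: `q ≡ 1 (mod 4)` (the dyadic
condition `d_K/4 ≡ 2, 3 (mod 4)` for a field discriminant divisible by `4`; `q = 2` is excluded by `(2/7) = +1`).
[folklore] -/
theorem prime_emod_four_eq_one_of_discr_eq {q : ℕ} (hq : q.Prime) (hq7 : jacobiSym q 7 = -1)
    (K : Type) [Field K] [NumberField K] (h2 : Module.finrank ℚ K = 2)
    (hdK : NumberField.discr K = -(4 * (q : ℤ))) : q % 4 = 1 := by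
  have h4 : (4 : ℤ) ∣ NumberField.discr K := ⟨-(q : ℤ), by rw [hdK]; ring⟩
  have h := QuadraticFields.Quadratic.discr_div_four_emod_four h2 h4
  rw [hdK, show -(4 * (q : ℤ)) / 4 = -(q : ℤ) by omega] at h
  have hq2 : q ≠ 2 := by
    rintro rfl
    exact absurd hq7 (by norm_num)
  rcases h with h | h
  · exfalso
    have h2q : 2 ∣ q := by omega
    rcases hq.eq_one_or_self_of_dvd 2 h2q with h1 | h1 <;> omega
  · omega

/-- **HONESTY CLAUSE: twin″ (route decl, BY NAME) and K12₂″ (route decl, BY NAME) together imply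
`X049BirchLemmaEvenDiscr`**, granted `2`-parity (`hpar`), Modularity (`hnf`), Coates–Li–Tian–Zhai Thm. 1.2 at `R = 1`
(`h12`), Burungale–Flach 2024 (`hBF`), Gross–Zagier (`hGZ`), Kolyvagin (`hKo`) and GZK (`hGZK`). Clause (i): K12₂″ gives
Conjecture D(q) (seat c201's `analyticRank_eq_one_inertPrimeTwist_of_crux`), so `ord L(X₀(49)/K) = 1` and the Heegner
point is off the torsion (Gross–Zagier dictionary). Clause (ii): twin″ gives `BSD(W,2)` for the minimal model `W` of
`49a1^{(−q)}` (`bsdTwo_negTwists_of_bsdTwoCMSevenAdditiveRankOne`, `r_an(W) = 1` by D(q)); file 2b converts it into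
`ord₂ 𝔮₄₉(k′) = 0` for ITS halvability value `k′`, and the halvability characterisation pins `k′ = k`. So LINE B49 is
EXACTLY the joint content of the two cruxes on the prime family — an `L`-free reformulation, neither weaker nor
stronger. [cite: DokchitserDokchitserAnnals2010, Thm. 1.4] [cite: CoatesLiTianZhai2015, Thm. 1.2 and Thm. 1.4]
[cite: GrossZagier1986, Thm. I.(6.3), V.§2 and I.§7] [cite: Miller2011LMS, Def. 1.1] -/
theorem birch_of_cruxes (hpar : ∀ (W : WeierstrassCurve ℚ) [W.IsElliptic], p_parity W 2)
    (hnf : ModularForms.exists_isNewformOf) (h12 : CoatesLiTianZhai2015.thm12_fullBSD_twist)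
    (hBF : bsdTriple_of_hasCM_of_L_one_ne_zero)
    (hGZ : ∀ (N : ℕ) [NeZero N] (W : WeierstrassCurve ℚ) (K : Type) [Field K] [NumberField K],
      gross_zagier N W K)
    (hKo : ∀ (N : ℕ) [NeZero N] (W : WeierstrassCurve ℚ) (K : Type) [Field K] [NumberField K],
      kolyvagin N W K)
    (hGZK : rank_eq_analyticRank_of_analyticRank_le_one)
    (hXT : Summit.BirchSwinnertonDyer.BirchSwinnertonDyer.Theses.GoldfeldAllTwistsTwoConverse.BSDTwoCMSevenAdditiveRankOne)
    (hXL : Summit.BirchSwinnertonDyer.BirchSwinnertonDyer.Theses.GoldfeldAllTwistsTwoConverse.RankOneTwoConverseCMSevenAdditiveTwo) :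
    X049BirchLemmaEvenDiscr := by
  intro q K _ _ Dt H ι P W _ _ Cd k hq hqj hK hdK hP hW hk12 hkiff
  haveI : Fact q.Prime := ⟨hq⟩
  have hmod : hasEntireLFunction_rat := hasEntireLFunction_rat_of_exists_isNewformOf hnf
  have hq4 : q % 4 = 1 := prime_emod_four_eq_one_of_discr_eq hq hqj K hK.1 hdK
  have hq7 : legendreSym q (-7) = -1 := by rw [← jacobiSym_seven_eq_legendreSym_neg_seven hq4, hqj]
  have hq0 : ((-q : ℤ) : ℚ) ≠ 0 := by
    have := hq.pos
    exact_mod_cast (show (-(q : ℤ)) ≠ 0 by omega)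
  haveI := cm7.isElliptic_quadraticTwist hq0
  -- Conjecture D(q) from K12₂″, on the model `X₀(49)^{(−q)}` itself and on `W`
  have hDt : (cm7.quadraticTwist ((-q : ℤ) : ℚ)).analyticRank = 1 :=
    analyticRank_eq_one_inertPrimeTwist_of_crux hpar hnf h12 hXL hq4 hq7 _ 1 (one_smul _ _)
  obtain ⟨C, hC⟩ := exists_smul_eq_quadraticTwist_neg_of_discr K hdK W Cd hW
  have har : W.analyticRank = 1 := analyticRank_eq_one_inertPrimeTwist_of_crux hpar hnf h12 hXL hq4 hq7 W C hC
  -- clause (i): the Heegner point is off the torsion (Gross–Zagier dictionary at `K`)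
  have hdK' : NumberField.discr K = 4 * (-(q : ℤ)) := by rw [hdK]; ring
  have hH : SatisfiesHeegnerHypothesis 49 K :=
    satisfiesHeegnerHypothesis_fortyNine_of_discr_eq K hK.1 hdK' (jacobiSym_neg_prime_seven hqj)
  have htw : cm7.quadraticTwist (NumberField.discr K : ℚ) =
      (⟨(Units.mk0 (2 : ℚ) two_ne_zero)⁻¹, 0, 0, 0⟩ : VariableChange ℚ) • cm7.quadraticTwist ((-q : ℤ) : ℚ) := by
    rw [hdK', show ((-q : ℤ) : ℚ) = ((-(q : ℤ) : ℤ) : ℚ) by push_cast; ring]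
    exact quadraticTwist_cm7_four_mul (-(q : ℤ))
  have hEK : analyticRankEK cm7 K = 1 := by
    rw [analyticRankEK_cm7 hmod h12 K, htw, analyticRank_smul]; exact hDt
  have hPH : IsHeegnerPoint 49 cm7 K P := ⟨Dt, H, ι, hP⟩
  have hPinf : ¬ IsOfFinAddOrder P :=
    (analyticRankEK_eq_one_iff_heegner_nonTorsion_of_exists_isNewformOf cm7 49 K (hGZ 49 cm7 K) hnf hK
      conductorNorm_cm7 hH hPH).mp hEK
  refine ⟨hPinf, ?_⟩
  -- clause (ii): twin″ at `W`, converted by file 2b, with the halvability value pinned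
  have hsq : Squarefree (-(q : ℤ)) := by
    rw [← Int.squarefree_natAbs, Int.natAbs_neg, Int.natAbs_natCast]
    exact hq.squarefree
  have h7 : ¬ (7 : ℤ) ∣ (-(q : ℤ)) := by
    intro h
    have h' : (7 : ℤ) ∣ (q : ℤ) := (dvd_neg).mp h
    have h7q : 7 ∣ q := by exact_mod_cast h'
    have hq7' : q = 7 := ((Nat.prime_dvd_prime_iff_eq (by norm_num) hq).mp h7q).symm
    subst hq7'
    exact absurd hqj (by norm_num)
  have hBSD : BSDp W 2 :=
    bsdTwo_negTwists_of_bsdTwoCMSevenAdditiveRankOne hXT (-(q : ℤ)) (by have := hq.pos; omega) hsq h7 (by omega)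
      W C (by exact_mod_cast hC) har
  obtain ⟨k', hk12', hkiff', hiff'⟩ := bsdp_two_iff_x049Quotient_unit_inertPrimeTwist hnf h12 hBF hGZ hKo hGZK hq4 hq7
    K hK hdK Dt H ι P hP W Cd hW har
  have hkk : k = k' := by
    rcases hk12 with rfl | rfl <;> rcases hk12' with rfl | rfl
    · rfl
    · exact absurd (hkiff.mpr (hkiff'.mp rfl)) (by decide)
    · exact absurd (hkiff'.mpr (hkiff.mp rfl)) (by decide)
    · rfl
  subst hkk
  exact hiff'.mp hBSD

/-- **LINE B49 ⟺ (twin″ ∧ K12₂″ restricted to the prime family)**, packaged: granted the standing binders, the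
even-discriminant Birch lemma follows from the two route decls, and implies both of their conclusions on every
minimal model of every `49a1^{(−q)}`. [cite: GrossZagier1986, Thm. I.(6.3) and V.§2] [cite: Miller2011LMS, Def. 1.1] -/
theorem birch_iff_cruxes_content (hpar : ∀ (W : WeierstrassCurve ℚ) [W.IsElliptic], p_parity W 2)
    (hnf : ModularForms.exists_isNewformOf) (h12 : CoatesLiTianZhai2015.thm12_fullBSD_twist)
    (hBF : bsdTriple_of_hasCM_of_L_one_ne_zero)
    (hGZ : ∀ (N : ℕ) [NeZero N] (W : WeierstrassCurve ℚ) (K : Type) [Field K] [NumberField K],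
      gross_zagier N W K)
    (hKo : ∀ (N : ℕ) [NeZero N] (W : WeierstrassCurve ℚ) (K : Type) [Field K] [NumberField K],
      kolyvagin N W K)
    (hGZK : rank_eq_analyticRank_of_analyticRank_le_one)
    (hHP : ∀ (W : WeierstrassCurve ℚ) (K : Type) [Field K] [NumberField K], exists_isHeegnerPoint W K) :
    (Summit.BirchSwinnertonDyer.BirchSwinnertonDyer.Theses.GoldfeldAllTwistsTwoConverse.BSDTwoCMSevenAdditiveRankOne →
      Summit.BirchSwinnertonDyer.BirchSwinnertonDyer.Theses.GoldfeldAllTwistsTwoConverse.RankOneTwoConverseCMSevenAdditiveTwo →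
        X049BirchLemmaEvenDiscr) ∧
    (X049BirchLemmaEvenDiscr → ∀ (q : ℕ) [Fact q.Prime], q % 4 = 1 → legendreSym q (-7) = -1 →
      ∀ (W : WeierstrassCurve ℚ) [W.IsElliptic] [W.IsGloballyMinimal] (C : VariableChange ℚ),
        C • W = cm7.quadraticTwist ((-q : ℤ) : ℚ) → W.analyticRank = 1 ∧ BSDp W 2) :=
  ⟨fun hXT hXL => birch_of_cruxes hpar hnf h12 hBF hGZ hKo hGZK hXT hXL,
    fun hB _ _ hq4 hq7 W _ _ C hC =>
      let h := cruxes_inertPrimeTwist_of_birch hnf h12 hBF hGZ hKo hGZK hHP hB hq4 hq7 W C hC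
      ⟨h.1, h.2.1⟩⟩

end Summit.BirchSwinnertonDyer.BirchSwinnertonDyer.Theorems.GoldfeldGoodTwists

end
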